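import Summits.ResolutionOfSingularities.ResolutionOfSingularities.Theorems.HomologicalConductorPersistencePointedCeilingResolution
import Literature.AlgebraicGeometry.Resolution.Lipman1969NegativeDefiniteHolds
import Literature.AlgebraicGeometry.Resolution.Lipman1969ClosedPointHolds
import HarnessLib

/-!
# Rung `PersistenceSurface` (stmt-ResolutionOfSingularities-19970), K-PCC Thm 2.3 resolution form — FACT-FREE:
# the binders `Lipman1969_14_1` and `Lipman1969_14_closedPoint` are theorems of the tree

Route `ResolutionOfSingularities/HomologicalConductor` (cell decomp-res, hand leafhand-res-homologicalconduct-9 g0).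
OURS: AI-written bookkeeping, weaker than expert review; nothing here is a statement of the manuscript under review
(Hironaka 2017).  SUPPORT level, counted 0.  Def-free, FACT-FREE.

`…PersistencePointedCeilingResolution` (the pointed-cycle ceiling `ca³(T) ⊆ I(Z⁽ᵗ⁾ − A⁽ᵗ⁾)` for a resolution of a normal
surface germ, K-PCC Thm 2.3) takes the named facts `Lipman1969_14_1` (negative definiteness, du Val) and
`Lipman1969_14_closedPoint` (closed points of a desingularization have codimension two) as binders.  Both are now
THEOREMS of the tree (`Lipman1969_14_1_holds`, `Literature/…/Lipman1969NegativeDefiniteHolds`, this hand;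
`Lipman1969_14_closedPoint_holds`, `Literature/…/Lipman1969ClosedPointHolds`), so the ceiling holds with NO fact binder:

* `hneg_holds` — the lattice hypothesis `0 ≤ Σ_i N_i (N·C_i) ⇒ N = 0` for the exceptional curves of any resolution of a
  two-dimensional normal Noetherian local domain;
* `least_sub_greatest_le_ord_of_mem_cohomologyAnnihilatorOfDegree_three_of_isResolution_factFree` — K-PCC Thm 2.3,
  resolution form, unconditionally.

References: J. Lipman, Publ. Math. IHÉS 36 (1969), §14 (p. 224) [`Lipman1969`]; S. B. Iyengar, R. Takahashi, IMRN 2016,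
Remark 2.13 [`IyengarTakahashi2014`].
-/

noncomputable section

-- single-problem summit: the doubled namespace component `ResolutionOfSingularities` is forced
set_option linter.dupNamespace false

open CategoryTheory AlgebraicGeometry TopologicalSpace IsLocalRing Order
open Literature.AlgebraicGeometry.Resolution Literature.RingTheory.CohomologyAnnihilator
open Literature.AlgebraicGeometry.Motives
open Summit.ResolutionOfSingularities.ResolutionOfSingularities.Theorems.NoZeno.SandwichCluster

universe u

namespace Summit.ResolutionOfSingularities.ResolutionOfSingularities.Theorems.HomologicalConductor.PersistencePointedCeiling

variable {X : Scheme.{u}} [IsIntegral X] [IsLocallyNoetherian X] {T : Type u} [CommRing T] [IsNoetherianRing T]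
  [IsLocalRing T] [IsDomain T] [IsIntegrallyClosed T] (π : X ⟶ Spec (.of T))

/-- **`hneg` FACT-FREE**: for the exceptional curves of a resolution of a two-dimensional normal Noetherian local domain,
`0 ≤ Σ_i N_i (Σ_j N_j (E_j·E_i))` forces `N = 0` (Lipman (14.1), now the tree theorem `Lipman1969_14_1_holds`).
[cite: Lipman1969, Lemma (14.1) (p. 224)] -/
theorem hneg_holds (h2 : ringKrullDim T = 2) (hπ : IsResolution π)
    (F : Finset X) (hFexc : ∀ η ∈ F, η ∈ excCurvePoints π) (hc : ∀ η ∈ F, IsEffectiveCartier (primeDivisorIdeal η))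
    (N : {η // η ∈ F} → ℤ)
    (hN : 0 ≤ ∑ i, N i * ∑ j, N j *
      excCurveDegree π (CartierDivisor.ofIsEffectiveCartier (primeDivisorIdeal (j : X)) (hc j j.2)) i) : N = 0 :=
  hneg_of_Lipman1969_14_1 π Lipman1969_14_1_holds h2 hπ F hFexc hc N hN

/-- **THE POINTED CEILING FOR A RESOLUTION OF A NORMAL SURFACE GERM (K-PCC Thm 2.3), FACT-FREE** — the statement of
`least_sub_greatest_le_ord_of_mem_cohomologyAnnihilatorOfDegree_three_of_isResolution` with its two named-fact binders
discharged by `Lipman1969_14_1_holds` and `Lipman1969_14_closedPoint_holds`: every non-zero `x ∈ ca³(T)` satisfies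
`Z₀ i − A₀ i ≤ ord_{E_i}(x)`. [cite: Lipman1969, Lemma (14.1) and Section 12 (pp. 220–224)]
[cite: IyengarTakahashi2014, Remark 2.13] -/
theorem least_sub_greatest_le_ord_of_mem_cohomologyAnnihilatorOfDegree_three_of_isResolution_factFree
    [DecidableEq X] (h2 : ringKrullDim T = 2) (hπ : IsResolution π)
    (F : Finset X) (hFeq : (F : Set X) = excCurvePoints π) (t : {η // η ∈ F})
    {γ : X} (hγ : coheight γ = 1) (hγE : π.base γ ≠ closedPoint T)
    (hΓ : ∀ i : {η // η ∈ F}, excCurveDegree π (CartierDivisor.ofIsEffectiveCartier (primeDivisorIdeal γ)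
      (isEffectiveCartier_primeDivisorIdeal_of_isRegular hπ.isRegular hγ)) i = (if i = t then 1 else 0))
    (Z₀ A₀ : {η // η ∈ F} → ℕ)
    (hZ₀ : ∀ Z : {η // η ∈ F} → ℕ, (∀ i : {η // η ∈ F}, ∑ j, (Z j : ℤ) *
        excCurveDegree π (CartierDivisor.ofIsEffectiveCartier (primeDivisorIdeal (j : X))
          (isEffectiveCartier_primeDivisorIdeal_of_isRegular hπ.isRegular
            (hπ.coheight_eq_one_of_mem_excCurvePoints h2 (hFeq ▸ j.2)))) i ≤
        -(if i = t then 1 else 0)) → Z₀ ≤ Z)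
    (hA₀ : ∀ A : {η // η ∈ F} → ℕ, (∀ i : {η // η ∈ F}, -(if i = t then (1 : ℤ) else 0) ≤ ∑ j, (A j : ℤ) *
        excCurveDegree π (CartierDivisor.ofIsEffectiveCartier (primeDivisorIdeal (j : X))
          (isEffectiveCartier_primeDivisorIdeal_of_isRegular hπ.isRegular
            (hπ.coheight_eq_one_of_mem_excCurvePoints h2 (hFeq ▸ j.2)))) i) → A ≤ A₀)
    {x : T} (hx : x ∈ cohomologyAnnihilatorOfDegree T 3) (hx0 : x ≠ 0) (i : {η // η ∈ F}) :
    (Z₀ i : ℤ) - A₀ i ≤ Scheme.ord (baseToFunctionField π x) i :=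
  least_sub_greatest_le_ord_of_mem_cohomologyAnnihilatorOfDegree_three_of_isResolution π Lipman1969_14_1_holds
    Lipman1969_14_closedPoint_holds h2 hπ F hFeq t hγ hγE hΓ Z₀ A₀ hZ₀ hA₀ hx hx0 i

end Summit.ResolutionOfSingularities.ResolutionOfSingularities.Theorems.HomologicalConductor.PersistencePointedCeiling

end
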